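import Summits.HodgeConjecture.HodgeConjecture.Theorems.SemiregularSheafRepresentativesTwAtDiag.Negative.SecantAnchorWeilPencilSupplyFalseOfOffType
import Literature.AlgebraicGeometry.HodgeTheory.WeilTypeAbelianVariety
import Literature.AlgebraicGeometry.HodgeTheory.WeilTypePeriodPoint
import Literature.AlgebraicGeometry.HodgeTheory.AlgebraicClassesHodgeTypeHolds

/-!
# `SemiregularSheafRepresentativesTwAtDiag` (stmt-HodgeConjecture-19787) · Negative · `SecantAnchorWeilPencilSupply`
# forces van Geemen's Weil-type condition on every hyperbolic datum it quantifies over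

Sequel of `…Negative.SecantAnchorWeilPencilSupplyFalseOfOffType` (`hsup ⟹ γ` of Hodge type `(3,3)`).  Read together with
Deligne–Milne Prop. 4.4 "only if" on the tree's carriers (`HodgeTheory.finrank_eq_of_mem_weilClassesOf`: a NON-ZERO class
of Hodge type `(n,n)` in the Weil plane `weilClassesOf A φ n d = ⋀²ⁿV₊ ⊕ ⋀²ⁿV₋` forces the multiplicity
`dim (V₊ ∩ H^{1,0}) = n`), the family-supply hypothesis
`Summit.HodgeConjecture.HodgeConjecture.Ring2.SemiregularRepresentatives.SecantAnchorWeilPencilSupply` turns out to assert a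
HODGE-THEORETIC RIGIDITY it never states: at `Y = P`, `q = 𝟙`, every complex abelian sixfold `P` with `ψ₀ ≫ ψ₀ = -d`, a
polarization class `h` (`IsPolarizationClass`: rational, divisor-supported, hard Lefschetz — no positivity) making `(P, ψ₀)`
hyperbolic (`IsHyperbolicWeilType`: a rational `ψ₀^*`-stable `Q_h`-Lagrangian `6`-frame of `H¹`) and a non-zero rational class
`γ` in the Weil plane is OF WEIL TYPE `(3,3)` in van Geemen's sense (`HodgeTheory.IsWeilType P ψ₀ 3 d`, LNM 1594, 4.9):

* `isWeilType_of_secantAnchorWeilPencilSupply` — `hsup ⟹ IsWeilType P ψ₀ 3 d` for every such `(d, P, ψ₀, h, γ)`;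
* `not_secantAnchorWeilPencilSupply_of_not_isWeilType`, `not_secantAnchorWeilPencilSupply_of_finrank_ne` — contrapositives:
  ONE hyperbolic datum of unbalanced `K`-multiplicities `(a, 6 - a)`, `a ≠ 3`, carrying a non-zero rational Weil class refutes
  the hypothesis.  The tree proves "hyperbolic ⟹ balanced" only for the POSITIVE `K`-symmetrised hyperplane class
  `h_K = d·e^*a + ψ₀^*e^*a` (`HodgeTheory.finrank_eigenspace_inf_hodgeOneZero_eq_of_isHyperbolicWeilType`, Hodge–Riemann in
  degree one + the signature bound `finrank_le_two_mul_min`); for an INDEFINITE polarization class nothing of the kind holds,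
  and the paper datum of the predecessor file (`E⁶`, `E` CM by `√-3`, `ψ₀ = r^{×6}` of multiplicities `(6,0)`,
  `h = ω₁+ω₂+ω₃-ω₄-ω₅-ω₆`, `γ = ∏ pr_k^* v₊ + ∏ pr_k^* v₋`) is such a datum.  So the binder the hypothesis is missing is,
  equivalently: `IsOfHodgeType 6 Y.X (2 * 3) 3 3 γ`, or `IsWeilType P ψ₀ 3 d`, or the tree-idiomatic typing of `h` as the
  `K`-symmetrised hyperplane class of a projective embedding (as in `HasLocallyAlgebraicWeilAnchor` /
  `weilFamilyReach_hyperbolic`), under which `isOfHodgeType_of_mem_weilClassesOf_of_isHyperbolicWeilType` discharges it.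

Refuter seat refuter-pub-hodge-ring2-refute-markman-g1-0 (REFUTE-MARKMAN-G1.md §2), 2026-08-27.  Theorems only (D-0026).
[cite: vanGeemen1994HodgeAV, 4.9, Lemma 5.2 and 5.3–5.5] [cite: Deligne1982HodgeCycles, §4 Prop. 4.4, Cor. 4.2 and Thm. 4.8]
[cite: VoisinHodgeI2002, §7.1.1–7.1.2]
-/

noncomputable section

open CategoryTheory
open Literature.AlgebraicTopology.SingularHomology
open Literature.AlgebraicGeometry Literature.AlgebraicGeometry.Motives Literature.AlgebraicGeometry.HodgeTheory

namespace Summit.HodgeConjecture.HodgeConjecture.Theorems.SemiregularSheafRepresentativesTwAtDiag.Negative.SecantAnchorWeilPencilSupplyForcesWeilType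

-- the cell's namespace repeats the summit name (`Summit.HodgeConjecture.HodgeConjecture…`), as in every `Ring2*` file
set_option linter.dupNamespace false

open Summit.HodgeConjecture.HodgeConjecture.Ring2.SemiregularRepresentatives
open Summit.HodgeConjecture.HodgeConjecture.Theorems.SemiregularSheafRepresentativesTwAtDiag.Negative.SecantAnchorWeilPencilSupplyFalseOfOffType

/-- **Multiples of `h³` are of Hodge type `(3,3)`** for a polarization class `h` of a sixfold: `h` is divisor-supported,
hence of type `(1,1)` (`isOfHodgeType_of_mem_algebraicClasses_of_isSmoothProjective`), and cup powers add types.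
[cite: VoisinHodgeI2002, §7.1.2 and §11.1.2] -/
theorem isOfHodgeType_smul_cupPowTwo {P : AbelianVariety ℂ} (hP : P.dim = 2 * 3) {h : complexBetti P.X 2}
    (hh : IsPolarizationClass 6 P.X h) (c : ℂ) : IsOfHodgeType (2 * 3) P.X (2 * 3) 3 3 (c • cupPowTwo h 3) := by
  have hX : IsSmoothProjective (2 * 3) P.X := Motives.isSmoothProjective_of_dim_eq' hP
  have h11 : IsOfHodgeType (2 * 3) P.X 2 1 1 h :=
    isOfHodgeType_of_mem_algebraicClasses_of_isSmoothProjective hX 1 hh.mem_algebraicClasses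
  exact (isOfHodgeType_cupPowTwo hX h11 3).smul c

/-- `(𝟙 P)^* = id` on `Hᵏ(P(ℂ); ℂ)` in the typing `q.hom.hom.hom` of the hypothesis. [cite: VoisinHodgeI2002, §7.1.2] -/
theorem complexBetti_map_id_apply {P : AbelianVariety ℂ} (k : ℕ) (x : complexBetti P.X k) :
    complexBetti.map (𝟙 P : P ⟶ P).hom.hom.hom k x = x := by
  change complexBetti.map (𝟙 P.X) k x = x
  rw [complexBetti.map_id]
  rfl

/-- **`SecantAnchorWeilPencilSupply` forces Weil type.**  Under the hypothesis, every complex abelian sixfold `P` with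
`ψ₀ ≫ ψ₀ = -d` (`d ≥ 1`), a polarization class `h` with `IsHyperbolicWeilType P ψ₀ 3 h`, and a non-zero rational class `γ`
in the Weil plane `weilClassesOf P ψ₀ 3 d` is of Weil type `(3,3)` (van Geemen 4.9: the eigenvalue `i√d` of `ψ₀^*` has
multiplicity `3` on `H^{1,0}`).  Proof: at `Y = P`, `q = 𝟙` the hypothesis (or, if `γ ∈ ℂ·h³`, the type `(3,3)` of `h³`)
makes `γ` of type `(3,3)`, and Deligne–Milne Prop. 4.4 (`finrank_eq_of_mem_weilClassesOf`) converts a non-zero `(3,3)` Weil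
class into balanced multiplicities. [cite: Deligne1982HodgeCycles, §4 Prop. 4.4] [cite: vanGeemen1994HodgeAV, 4.9–4.10] -/
theorem isWeilType_of_secantAnchorWeilPencilSupply (hsup : SecantAnchorWeilPencilSupply)
    {d : ℕ} {P : AbelianVariety ℂ} {ψ₀ : P ⟶ P} {h : complexBetti P.X 2} {γ : complexBetti P.X (2 * 3)}
    (hd : 0 < d) (hP : P.dim = 2 * 3) (hψ : ψ₀ ≫ ψ₀ = -(d • 𝟙 P)) (hh : IsPolarizationClass 6 P.X h)
    (hhyp : IsHyperbolicWeilType P ψ₀ 3 h) (hγr : IsRationalClass γ) (hγW : γ ∈ weilClassesOf P ψ₀ 3 d) (hγ0 : γ ≠ 0) :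
    IsWeilType P ψ₀ 3 d := by
  refine ⟨by norm_num, hd, hP, hψ, finrank_eq_of_mem_weilClassesOf (by norm_num) hP hd hψ hγW hγ0 ?_⟩
  by_cases hγh : γ ∈ (ℂ ∙ cupPowTwo h 3)
  · obtain ⟨c, rfl⟩ := Submodule.mem_span_singleton.1 hγh
    exact isOfHodgeType_smul_cupPowTwo hP hh c
  · have hP6 : P.dim = 6 := hP
    have hq : ∀ k : ℕ, Function.Bijective (complexBetti.map (𝟙 P : P ⟶ P).hom.hom.hom k) := fun k ↦
      ⟨fun x y hxy ↦ by rwa [complexBetti_map_id_apply, complexBetti_map_id_apply] at hxy,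
        fun y ↦ ⟨y, complexBetti_map_id_apply k y⟩⟩
    have hhyp' : IsHyperbolicWeilType P ψ₀ 3 (complexBetti.map (𝟙 P : P ⟶ P).hom.hom.hom 2 h) := by
      rw [complexBetti_map_id_apply]; exact hhyp
    have hγW' : complexBetti.map (𝟙 P : P ⟶ P).hom.hom.hom (2 * 3) γ ∈ weilClassesOf P ψ₀ 3 d := by
      rw [complexBetti_map_id_apply]; exact hγW
    exact isOfHodgeType_of_secantAnchorWeilPencilSupply hsup hd hP6 hP6 hψ hq hh hhyp' hγr hγh hγW'

/-- **Contrapositive: one hyperbolic sixfold datum NOT of Weil type refutes `SecantAnchorWeilPencilSupply`.**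
[cite: Deligne1982HodgeCycles, §4 Prop. 4.4] [cite: vanGeemen1994HodgeAV, Lemma 5.2] -/
theorem not_secantAnchorWeilPencilSupply_of_not_isWeilType
    {d : ℕ} {P : AbelianVariety ℂ} {ψ₀ : P ⟶ P} {h : complexBetti P.X 2} {γ : complexBetti P.X (2 * 3)}
    (hd : 0 < d) (hP : P.dim = 2 * 3) (hψ : ψ₀ ≫ ψ₀ = -(d • 𝟙 P)) (hh : IsPolarizationClass 6 P.X h)
    (hhyp : IsHyperbolicWeilType P ψ₀ 3 h) (hγr : IsRationalClass γ) (hγW : γ ∈ weilClassesOf P ψ₀ 3 d) (hγ0 : γ ≠ 0)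
    (hW : ¬ IsWeilType P ψ₀ 3 d) : ¬ SecantAnchorWeilPencilSupply := fun hsup ↦
  hW (isWeilType_of_secantAnchorWeilPencilSupply hsup hd hP hψ hh hhyp hγr hγW hγ0)

/-- **Multiplicity form**: a hyperbolic sixfold datum with a non-zero rational Weil class and `K`-multiplicity
`dim (V₊ ∩ H^{1,0}) ≠ 3` (e.g. `(6,0)`: `ψ₀ = r^{×6}` on `E⁶`) refutes `SecantAnchorWeilPencilSupply`.
[cite: vanGeemen1994HodgeAV, 4.9 and Lemma 5.2] -/
theorem not_secantAnchorWeilPencilSupply_of_finrank_ne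
    {d : ℕ} {P : AbelianVariety ℂ} {ψ₀ : P ⟶ P} {h : complexBetti P.X 2} {γ : complexBetti P.X (2 * 3)}
    (hd : 0 < d) (hP : P.dim = 2 * 3) (hψ : ψ₀ ≫ ψ₀ = -(d • 𝟙 P)) (hh : IsPolarizationClass 6 P.X h)
    (hhyp : IsHyperbolicWeilType P ψ₀ 3 h) (hγr : IsRationalClass γ) (hγW : γ ∈ weilClassesOf P ψ₀ 3 d) (hγ0 : γ ≠ 0)
    (hne : Module.finrank ℂ ↥(Module.End.eigenspace (complexBetti.map ψ₀.hom.hom.hom 1).hom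
        (Complex.I * (Real.sqrt d : ℂ)) ⊓ hodgeOneZero (Motives.isSmoothProjective_of_dim_eq' hP)) ≠ 3) :
    ¬ SecantAnchorWeilPencilSupply :=
  not_secantAnchorWeilPencilSupply_of_not_isWeilType hd hP hψ hh hhyp hγr hγW hγ0 fun hW ↦ hne hW.multiplicity_eq

end Summit.HodgeConjecture.HodgeConjecture.Theorems.SemiregularSheafRepresentativesTwAtDiag.Negative.SecantAnchorWeilPencilSupplyForcesWeilType

end
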